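import Mathlib
import Summits.Ventures.PercRepro.TriangleCapThreeBelowFourTrianglesA

/-!
# PercRepro — THREE BELOW THE DIAGONAL, FOUR TRIANGLES, PART B: THE TRANSVERSAL PAIRS (p3, gen 38; part 108)

A «transversal» pair: an ordered adjacent pair `(x, y)` in no triangle (`codeg = 0`) with deficit `0`
(`N(x) ∪ N(y) = V`); by part A it meets every triangle.  For four triangles `T₁, …, T₄` (pairwise sharing at most
one vertex) the transversal pairs are few:
* `not_both_mem` — `x, y` are not both in a `T_i` (the third vertex is a common neighbour);
* `inter_eq_empty_of_star` — a triangle through `x` and one through `y` are vertex-disjoint (a common vertex is a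
  common neighbour of `x` and `y`);
* `mem_at_most_one` — a vertex off `{x, y}` lies in at most one of the four triangles;
* `share_vertex` — two transversal pairs share a vertex (else the second one's ends cover at most two triangles);
* `mem_all_of_two` — two transversal pairs `(c, y)`, `(c, y′)` with `y ≠ y′` force `c` into every triangle (a
  triangle missing `c` contains `y` and `y′`, and `c y y′` would be a triangle on `(c, y)`);
* **`card_transversal_le`** — the transversal pairs number at most `2`, or all pass through a vertex `c` lying in
  all four triangles with the other end outside `T₁ ∪ T₂ ∪ T₃ ∪ T₄` (nine vertices): at most `2 (k − 9)` of them.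
Axioms: standard.
-/

namespace PercRepro

namespace TriangleCap

namespace C047

open Finset

variable {V : Type*} [Fintype V] [DecidableEq V]

/-- Two distinct 3-cliques of a `K₄⁻`-free graph share at most one vertex. -/
theorem inter_card_le_one_of_ne (D : SimpleGraph V) [DecidableRel D.Adj] (hK : K4mFree D) {T T' : Finset V}
    (hT : T.card = 3) (hT' : T'.card = 3) (hcl : ∀ x ∈ T, ∀ y ∈ T, x ≠ y → D.Adj x y)
    (hcl' : ∀ x ∈ T', ∀ y ∈ T', x ≠ y → D.Adj x y) (hne : T ≠ T') : (T ∩ T').card ≤ 1 := by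
  by_contra h
  push Not at h
  obtain ⟨x, hx, y, hy, hxy⟩ := one_lt_card.mp h
  rw [mem_inter] at hx hy
  obtain ⟨t, ht, hxt, hyt⟩ := exists_third_of_clique D hT hcl hx.1 hy.1 hxy
  obtain ⟨t', ht', hxt', hyt'⟩ := exists_third_of_clique D hT' hcl' hx.2 hy.2 hxy
  have hxy' : D.Adj x y := hcl x hx.1 y hy.1 hxy
  have htt := eq_of_common_nbr D hK hxy' hxt hyt hxt' hyt'
  subst htt
  have hsub : ({x, y, t} : Finset V) ⊆ T := by
    intro z hz
    simp only [mem_insert, mem_singleton] at hz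
    rcases hz with rfl | rfl | rfl
    · exact hx.1
    · exact hy.1
    · exact ht
  have hsub' : ({x, y, t} : Finset V) ⊆ T' := by
    intro z hz
    simp only [mem_insert, mem_singleton] at hz
    rcases hz with rfl | rfl | rfl
    · exact hx.2
    · exact hy.2
    · exact ht'
  have h3 : ({x, y, t} : Finset V).card = 3 := card_triple hxy hxt.ne hyt.ne
  have e1 : ({x, y, t} : Finset V) = T := eq_of_subset_of_card_le hsub (by omega)
  have e2 : ({x, y, t} : Finset V) = T' := eq_of_subset_of_card_le hsub' (by omega)
  exact hne (e1.symm.trans e2)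

omit [Fintype V] in
/-- `T ∩ T′ = {c}` when the intersection has at most one element and `c` lies in both. -/
theorem inter_eq_singleton_of_mem {T T' : Finset V} (h : (T ∩ T').card ≤ 1) {c : V} (hc : c ∈ T)
    (hc' : c ∈ T') : T ∩ T' = {c} := by
  apply eq_singleton_iff_unique_mem.mpr
  refine ⟨mem_inter.mpr ⟨hc, hc'⟩, fun x hx => ?_⟩
  exact card_le_one.mp h x hx c (mem_inter.mpr ⟨hc, hc'⟩)

omit [DecidableEq V] in
/-- A codeg-`0` pair has no common neighbour. -/
theorem not_common_of_codeg_zero (D : SimpleGraph V) [DecidableRel D.Adj] {x y : V}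
    (h0 : codeg D (x, y) = 0) {z : V} (hxz : D.Adj x z) (hyz : D.Adj y z) : False := by
  unfold codeg at h0
  rw [card_eq_zero, filter_eq_empty_iff] at h0
  exact h0 (mem_univ z) ⟨hxz, hyz⟩

/-- A codeg-`0` adjacent pair does not lie inside a 3-clique. -/
theorem not_both_mem (D : SimpleGraph V) [DecidableRel D.Adj] {T : Finset V} (hT : T.card = 3)
    (hcl : ∀ x ∈ T, ∀ y ∈ T, x ≠ y → D.Adj x y) {x y : V} (hxy : D.Adj x y) (h0 : codeg D (x, y) = 0)
    (hx : x ∈ T) (hy : y ∈ T) : False := by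
  obtain ⟨t, -, hxt, hyt⟩ := exists_third_of_clique D hT hcl hx hy hxy.ne
  exact not_common_of_codeg_zero D h0 hxt hyt

/-- For a codeg-`0` pair `(x, y)`, a 3-clique through `x` and one through `y` are disjoint. -/
theorem inter_eq_empty_of_star (D : SimpleGraph V) [DecidableRel D.Adj] {T T' : Finset V} (hT : T.card = 3)
    (hT' : T'.card = 3) (hcl : ∀ x ∈ T, ∀ y ∈ T, x ≠ y → D.Adj x y)
    (hcl' : ∀ x ∈ T', ∀ y ∈ T', x ≠ y → D.Adj x y) {x y : V} (hxy : D.Adj x y) (h0 : codeg D (x, y) = 0)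
    (hx : x ∈ T) (hy : y ∈ T') : T ∩ T' = ∅ := by
  rw [eq_empty_iff_forall_notMem]
  intro z hz
  rw [mem_inter] at hz
  have hzx : z ≠ x := fun h => not_both_mem D hT' hcl' hxy h0 (h ▸ hz.2) hy
  have hzy : z ≠ y := fun h => not_both_mem D hT hcl hxy h0 hx (h ▸ hz.1)
  exact not_common_of_codeg_zero D h0 (hcl x hx z hz.1 hzx.symm) (hcl' y hy z hz.2 hzy.symm)

/-- A vertex off a transversal pair `{x, y}` lies in at most one of two distinct 3-cliques each meeting `{x, y}`. -/
theorem not_mem_both_of_transversal (D : SimpleGraph V) [DecidableRel D.Adj] {T T' : Finset V}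
    (hT : T.card = 3) (hT' : T'.card = 3) (hcl : ∀ x ∈ T, ∀ y ∈ T, x ≠ y → D.Adj x y)
    (hcl' : ∀ x ∈ T', ∀ y ∈ T', x ≠ y → D.Adj x y) (hint : (T ∩ T').card ≤ 1) {x y : V} (hxy : D.Adj x y)
    (h0 : codeg D (x, y) = 0) (hm : x ∈ T ∨ y ∈ T) (hm' : x ∈ T' ∨ y ∈ T') {v : V} (hvx : v ≠ x) (hvy : v ≠ y)
    (hv : v ∈ T) (hv' : v ∈ T') : False := by
  have h0' : codeg D (y, x) = 0 := by rw [codeg_comm]; exact h0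
  rcases hm with hm | hm <;> rcases hm' with hm' | hm'
  · have : (T ∩ T').card ≥ 2 := by
      have hsub : ({x, v} : Finset V) ⊆ T ∩ T' := by
        intro z hz
        simp only [mem_insert, mem_singleton] at hz
        rcases hz with rfl | rfl
        · exact mem_inter.mpr ⟨hm, hm'⟩
        · exact mem_inter.mpr ⟨hv, hv'⟩
      have := card_le_card hsub
      rw [card_pair (Ne.symm hvx)] at this
      exact this
    omega
  · have he := inter_eq_empty_of_star D hT hT' hcl hcl' hxy h0 hm hm'
    have : v ∈ T ∩ T' := mem_inter.mpr ⟨hv, hv'⟩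
    rw [he] at this
    exact notMem_empty v this
  · have he := inter_eq_empty_of_star D hT' hT hcl' hcl hxy h0 hm' hm
    have : v ∈ T' ∩ T := mem_inter.mpr ⟨hv', hv⟩
    rw [he] at this
    exact notMem_empty v this
  · have : (T ∩ T').card ≥ 2 := by
      have hsub : ({y, v} : Finset V) ⊆ T ∩ T' := by
        intro z hz
        simp only [mem_insert, mem_singleton] at hz
        rcases hz with rfl | rfl
        · exact mem_inter.mpr ⟨hm, hm'⟩
        · exact mem_inter.mpr ⟨hv, hv'⟩
      have := card_le_card hsub
      rw [card_pair (Ne.symm hvy)] at this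
      exact this
    omega

omit [Fintype V] [DecidableEq V] in
/-- The pigeonhole of four disjunctions: if each of four slots holds `P` or `Q`, no two slots both hold `P`, and no
two of the first three both hold `Q`, there is a contradiction. -/
theorem pigeon_four {P₁ P₂ P₃ P₄ Q₁ Q₂ Q₃ Q₄ : Prop} (h₁ : P₁ ∨ Q₁) (h₂ : P₂ ∨ Q₂) (h₃ : P₃ ∨ Q₃) (h₄ : P₄ ∨ Q₄)
    (p₁₂ : ¬ (P₁ ∧ P₂)) (p₁₃ : ¬ (P₁ ∧ P₃)) (p₁₄ : ¬ (P₁ ∧ P₄)) (p₂₃ : ¬ (P₂ ∧ P₃)) (p₂₄ : ¬ (P₂ ∧ P₄))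
    (p₃₄ : ¬ (P₃ ∧ P₄)) (q₁₂ : ¬ (Q₁ ∧ Q₂)) (q₁₃ : ¬ (Q₁ ∧ Q₃)) (q₂₃ : ¬ (Q₂ ∧ Q₃)) : False := by
  rcases h₁ with h₁ | h₁ <;> rcases h₂ with h₂ | h₂ <;> rcases h₃ with h₃ | h₃ <;> rcases h₄ with h₄ | h₄ <;>
    first
    | exact p₁₂ ⟨h₁, h₂⟩ | exact p₁₃ ⟨h₁, h₃⟩ | exact p₁₄ ⟨h₁, h₄⟩ | exact p₂₃ ⟨h₂, h₃⟩ | exact p₂₄ ⟨h₂, h₄⟩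
    | exact p₃₄ ⟨h₃, h₄⟩ | exact q₁₂ ⟨h₁, h₂⟩ | exact q₁₃ ⟨h₁, h₃⟩ | exact q₂₃ ⟨h₂, h₃⟩

/-- A vertex off a 3-clique of a `K₄⁻`-free graph has at most one neighbour in it (the Finset form of
`degIn_le_one_of_triangle`). -/
theorem degIn_le_one_of_clique (D : SimpleGraph V) [DecidableRel D.Adj] (hK : K4mFree D) {T : Finset V}
    (hT : T.card = 3) (hcl : ∀ x ∈ T, ∀ y ∈ T, x ≠ y → D.Adj x y) {z : V} (hz : z ∉ T) : degIn D T z ≤ 1 := by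
  obtain ⟨u, v, w, huv, huw, hvw, rfl⟩ := card_eq_three.mp hT
  have hu : u ∈ ({u, v, w} : Finset V) := mem_insert_self _ _
  have hv : v ∈ ({u, v, w} : Finset V) := mem_insert_of_mem (mem_insert_self _ _)
  have hw : w ∈ ({u, v, w} : Finset V) := mem_insert_of_mem (mem_insert_of_mem (mem_singleton_self _))
  exact degIn_le_one_of_triangle D hK (hcl u hu v hv huv) (hcl u hu w hw huw) (hcl v hv w hw hvw) hz

/-- **TWO TRANSVERSAL PAIRS SHARE A VERTEX.** -/
theorem share_vertex (D : SimpleGraph V) [DecidableRel D.Adj] (hK : K4mFree D) (T₁ T₂ T₃ T₄ : Finset V)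
    (h₁ : T₁.card = 3) (h₂ : T₂.card = 3) (h₃ : T₃.card = 3) (h₄ : T₄.card = 3)
    (hcl₁ : ∀ x ∈ T₁, ∀ y ∈ T₁, x ≠ y → D.Adj x y) (hcl₂ : ∀ x ∈ T₂, ∀ y ∈ T₂, x ≠ y → D.Adj x y)
    (hcl₃ : ∀ x ∈ T₃, ∀ y ∈ T₃, x ≠ y → D.Adj x y) (hcl₄ : ∀ x ∈ T₄, ∀ y ∈ T₄, x ≠ y → D.Adj x y)
    (h12 : (T₁ ∩ T₂).card ≤ 1) (h13 : (T₁ ∩ T₃).card ≤ 1) (h14 : (T₁ ∩ T₄).card ≤ 1)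
    (h23 : (T₂ ∩ T₃).card ≤ 1) (h24 : (T₂ ∩ T₄).card ≤ 1) (h34 : (T₃ ∩ T₄).card ≤ 1)
    {x y x' y' : V} (hxy : D.Adj x y) (h0 : codeg D (x, y) = 0) (hd : deficit D (x, y) = 0)
    (hd' : deficit D (x', y') = 0) :
    x' = x ∨ x' = y ∨ y' = x ∨ y' = y := by
  by_contra h
  push Not at h
  obtain ⟨hx'x, hx'y, hy'x, hy'y⟩ := h
  have hone₁ : ∀ z, z ∉ T₁ → degIn D T₁ z ≤ 1 := fun z hz => degIn_le_one_of_clique D hK h₁ hcl₁ hz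
  have hone₂ : ∀ z, z ∉ T₂ → degIn D T₂ z ≤ 1 := fun z hz => degIn_le_one_of_clique D hK h₂ hcl₂ hz
  have hone₃ : ∀ z, z ∉ T₃ → degIn D T₃ z ≤ 1 := fun z hz => degIn_le_one_of_clique D hK h₃ hcl₃ hz
  have hone₄ : ∀ z, z ∉ T₄ → degIn D T₄ z ≤ 1 := fun z hz => degIn_le_one_of_clique D hK h₄ hcl₄ hz
  have m₁ := mem_of_deficit_zero D h₁ hone₁ hd
  have m₂ := mem_of_deficit_zero D h₂ hone₂ hd
  have m₃ := mem_of_deficit_zero D h₃ hone₃ hd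
  have m₄ := mem_of_deficit_zero D h₄ hone₄ hd
  have m₁' := mem_of_deficit_zero D h₁ hone₁ hd'
  have m₂' := mem_of_deficit_zero D h₂ hone₂ hd'
  have m₃' := mem_of_deficit_zero D h₃ hone₃ hd'
  have m₄' := mem_of_deficit_zero D h₄ hone₄ hd'
  exact pigeon_four m₁' m₂' m₃' m₄'
    (fun ⟨a, b⟩ => not_mem_both_of_transversal D h₁ h₂ hcl₁ hcl₂ h12 hxy h0 m₁ m₂ hx'x hx'y a b)
    (fun ⟨a, b⟩ => not_mem_both_of_transversal D h₁ h₃ hcl₁ hcl₃ h13 hxy h0 m₁ m₃ hx'x hx'y a b)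
    (fun ⟨a, b⟩ => not_mem_both_of_transversal D h₁ h₄ hcl₁ hcl₄ h14 hxy h0 m₁ m₄ hx'x hx'y a b)
    (fun ⟨a, b⟩ => not_mem_both_of_transversal D h₂ h₃ hcl₂ hcl₃ h23 hxy h0 m₂ m₃ hx'x hx'y a b)
    (fun ⟨a, b⟩ => not_mem_both_of_transversal D h₂ h₄ hcl₂ hcl₄ h24 hxy h0 m₂ m₄ hx'x hx'y a b)
    (fun ⟨a, b⟩ => not_mem_both_of_transversal D h₃ h₄ hcl₃ hcl₄ h34 hxy h0 m₃ m₄ hx'x hx'y a b)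
    (fun ⟨a, b⟩ => not_mem_both_of_transversal D h₁ h₂ hcl₁ hcl₂ h12 hxy h0 m₁ m₂ hy'x hy'y a b)
    (fun ⟨a, b⟩ => not_mem_both_of_transversal D h₁ h₃ hcl₁ hcl₃ h13 hxy h0 m₁ m₃ hy'x hy'y a b)
    (fun ⟨a, b⟩ => not_mem_both_of_transversal D h₂ h₃ hcl₂ hcl₃ h23 hxy h0 m₂ m₃ hy'x hy'y a b)

/-- **TWO TRANSVERSAL PAIRS AT `c` WITH DIFFERENT OTHER ENDS PUT `c` IN EVERY TRIANGLE.** -/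
theorem mem_of_two_transversal (D : SimpleGraph V) [DecidableRel D.Adj] (hK : K4mFree D) {T : Finset V}
    (hT : T.card = 3) (hcl : ∀ x ∈ T, ∀ y ∈ T, x ≠ y → D.Adj x y) {c y y' : V} (hyy' : y ≠ y')
    (hcy' : D.Adj c y') (h0 : codeg D (c, y) = 0) (hd : deficit D (c, y) = 0) (hd' : deficit D (c, y') = 0) :
    c ∈ T := by
  by_contra hc
  have hone : ∀ z, z ∉ T → degIn D T z ≤ 1 := fun z hz => degIn_le_one_of_clique D hK hT hcl hz
  have hy : y ∈ T := (mem_of_deficit_zero D hT hone hd).resolve_left hc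
  have hy' : y' ∈ T := (mem_of_deficit_zero D hT hone hd').resolve_left hc
  exact not_common_of_codeg_zero D h0 hcy' (hcl y hy y' hy' hyy')

omit [DecidableEq V] in
/-- Membership in the transversal pairs. -/
theorem mem_transversal (D : SimpleGraph V) [DecidableRel D.Adj] (p : V × V) :
    p ∈ (adjPairsAll D).filter (fun p => codeg D p = 0 ∧ deficit D p = 0) ↔
      D.Adj p.1 p.2 ∧ codeg D p = 0 ∧ deficit D p = 0 := by
  rw [mem_filter, mem_adjPairsAll]

omit [DecidableEq V] in
/-- The transversal pairs are closed under the swap. -/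
theorem swap_mem_transversal (D : SimpleGraph V) [DecidableRel D.Adj] {p : V × V}
    (hp : p ∈ (adjPairsAll D).filter (fun p => codeg D p = 0 ∧ deficit D p = 0)) :
    p.swap ∈ (adjPairsAll D).filter (fun p => codeg D p = 0 ∧ deficit D p = 0) := by
  rw [mem_transversal] at hp ⊢
  obtain ⟨h1, h2, h3⟩ := hp
  refine ⟨h1.symm, ?_, ?_⟩
  · show codeg D (p.2, p.1) = 0
    rw [codeg_comm]; exact h2
  · show deficit D (p.2, p.1) = 0
    rw [deficit_comm]; exact h3

/-- **THE TRANSVERSAL PAIRS ARE FEW:** at most two, or all through a vertex `c` of every triangle with the other end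
off `T₁ ∪ T₂ ∪ T₃ ∪ T₄`. -/
theorem card_transversal_le (D : SimpleGraph V) [DecidableRel D.Adj] (hK : K4mFree D) (T₁ T₂ T₃ T₄ : Finset V)
    (h₁ : T₁.card = 3) (h₂ : T₂.card = 3) (h₃ : T₃.card = 3) (h₄ : T₄.card = 3)
    (hcl₁ : ∀ x ∈ T₁, ∀ y ∈ T₁, x ≠ y → D.Adj x y) (hcl₂ : ∀ x ∈ T₂, ∀ y ∈ T₂, x ≠ y → D.Adj x y)
    (hcl₃ : ∀ x ∈ T₃, ∀ y ∈ T₃, x ≠ y → D.Adj x y) (hcl₄ : ∀ x ∈ T₄, ∀ y ∈ T₄, x ≠ y → D.Adj x y)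
    (h12 : (T₁ ∩ T₂).card ≤ 1) (h13 : (T₁ ∩ T₃).card ≤ 1) (h14 : (T₁ ∩ T₄).card ≤ 1)
    (h23 : (T₂ ∩ T₃).card ≤ 1) (h24 : (T₂ ∩ T₄).card ≤ 1) (h34 : (T₃ ∩ T₄).card ≤ 1) :
    ((adjPairsAll D).filter (fun p => codeg D p = 0 ∧ deficit D p = 0)).card ≤ 2 ∨
    ∃ c, c ∈ T₁ ∧ c ∈ T₂ ∧ c ∈ T₃ ∧ c ∈ T₄ ∧
      ∀ p ∈ (adjPairsAll D).filter (fun p => codeg D p = 0 ∧ deficit D p = 0),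
        (p.1 = c ∧ p.2 ∉ T₁ ∪ T₂ ∪ T₃ ∪ T₄) ∨ (p.2 = c ∧ p.1 ∉ T₁ ∪ T₂ ∪ T₃ ∪ T₄) := by
  set Tr := (adjPairsAll D).filter (fun p => codeg D p = 0 ∧ deficit D p = 0) with hTr
  have hshare : ∀ p ∈ Tr, ∀ q ∈ Tr, q.1 = p.1 ∨ q.1 = p.2 ∨ q.2 = p.1 ∨ q.2 = p.2 := by
    intro p hp q hq
    rw [hTr, mem_transversal] at hp hq
    exact share_vertex D hK T₁ T₂ T₃ T₄ h₁ h₂ h₃ h₄ hcl₁ hcl₂ hcl₃ hcl₄ h12 h13 h14 h23 h24 h34 hp.1 hp.2.1 hp.2.2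
      hq.2.2
  by_cases hex : ∃ p ∈ Tr, ∃ q ∈ Tr, q ≠ p ∧ q ≠ p.swap
  · right
    obtain ⟨p, hp, q, hq, hqp, hqs⟩ := hex
    -- the common vertex `c` and the two other ends
    have key : ∃ c y₀ y₁, y₀ ≠ y₁ ∧ (c, y₀) ∈ Tr ∧ (c, y₁) ∈ Tr := by
      obtain ⟨x, y⟩ := p
      obtain ⟨x', y'⟩ := q
      have hps := swap_mem_transversal D hp
      have hqs' := swap_mem_transversal D hq
      simp only [Prod.swap] at hps hqs'
      simp only [ne_eq, Prod.mk.injEq, Prod.swap, not_and] at hqp hqs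
      rcases hshare (x, y) hp (x', y') hq with h | h | h | h
      · subst h
        exact ⟨x', y, y', fun e => hqp rfl e.symm, hp, hq⟩
      · subst h
        exact ⟨x', x, y', fun e => hqs rfl e.symm, hps, hq⟩
      · subst h
        exact ⟨y', y, x', fun e => hqs e.symm rfl, hp, hqs'⟩
      · subst h
        exact ⟨y', x, x', fun e => hqp e.symm rfl, hps, hqs'⟩
    obtain ⟨c, y₀, y₁, hne, hc0, hc1⟩ := key
    have hc0' := hc0
    have hc1' := hc1
    rw [hTr, mem_transversal] at hc0' hc1'
    have hcT : c ∈ T₁ ∧ c ∈ T₂ ∧ c ∈ T₃ ∧ c ∈ T₄ :=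
      ⟨mem_of_two_transversal D hK h₁ hcl₁ hne hc1'.1 hc0'.2.1 hc0'.2.2 hc1'.2.2,
       mem_of_two_transversal D hK h₂ hcl₂ hne hc1'.1 hc0'.2.1 hc0'.2.2 hc1'.2.2,
       mem_of_two_transversal D hK h₃ hcl₃ hne hc1'.1 hc0'.2.1 hc0'.2.2 hc1'.2.2,
       mem_of_two_transversal D hK h₄ hcl₄ hne hc1'.1 hc0'.2.1 hc0'.2.2 hc1'.2.2⟩
    refine ⟨c, hcT.1, hcT.2.1, hcT.2.2.1, hcT.2.2.2, ?_⟩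
    intro r hr
    obtain ⟨a, b⟩ := r
    -- every transversal pair passes through `c`
    have hrc : a = c ∨ b = c := by
      by_contra hno
      push Not at hno
      have s0 := hshare (c, y₀) hc0 (a, b) hr
      have s1 := hshare (c, y₁) hc1 (a, b) hr
      simp only at s0 s1
      have hr' := hr
      rw [hTr, mem_transversal] at hr'
      simp only at hr'
      rcases s0 with e | e | e | e <;> rcases s1 with e' | e' | e' | e'
      all_goals first
        | exact hno.1 e | exact hno.1 e' | exact hno.2 e | exact hno.2 e'
        | exact hne (e.symm.trans e')
        | exact not_common_of_codeg_zero D hc0'.2.1 hc1'.1 (by rw [← e, ← e']; exact hr'.1)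
        | exact not_common_of_codeg_zero D hc0'.2.1 hc1'.1 (by rw [← e, ← e']; exact hr'.1.symm)
    have hr' := hr
    rw [hTr, mem_transversal] at hr'
    simp only at hr'
    rcases hrc with e | e
    · left
      refine ⟨e, ?_⟩
      intro hU
      rw [mem_union, mem_union, mem_union] at hU
      rw [e] at hr'
      rcases hU with ((h | h) | h) | h
      · exact not_both_mem D h₁ hcl₁ hr'.1 hr'.2.1 hcT.1 h
      · exact not_both_mem D h₂ hcl₂ hr'.1 hr'.2.1 hcT.2.1 h
      · exact not_both_mem D h₃ hcl₃ hr'.1 hr'.2.1 hcT.2.2.1 h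
      · exact not_both_mem D h₄ hcl₄ hr'.1 hr'.2.1 hcT.2.2.2 h
    · right
      refine ⟨e, ?_⟩
      intro hU
      rw [mem_union, mem_union, mem_union] at hU
      rw [e] at hr'
      rcases hU with ((h | h) | h) | h
      · exact not_both_mem D h₁ hcl₁ hr'.1 hr'.2.1 h hcT.1
      · exact not_both_mem D h₂ hcl₂ hr'.1 hr'.2.1 h hcT.2.1
      · exact not_both_mem D h₃ hcl₃ hr'.1 hr'.2.1 h hcT.2.2.1
      · exact not_both_mem D h₄ hcl₄ hr'.1 hr'.2.1 h hcT.2.2.2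
  · left
    push Not at hex
    rcases Tr.eq_empty_or_nonempty with he | ⟨p, hp⟩
    · rw [he, card_empty]; exact Nat.zero_le _
    · have hsub : Tr ⊆ {p, p.swap} := by
        intro q hq
        rw [mem_insert, mem_singleton]
        by_cases h : q = p
        · exact Or.inl h
        · exact Or.inr (hex p hp q hq h)
      have := card_le_card hsub
      have h2 : ({p, p.swap} : Finset (V × V)).card ≤ 2 := by
        calc ({p, p.swap} : Finset (V × V)).card ≤ ({p.swap} : Finset (V × V)).card + 1 := card_insert_le _ _
          _ = 2 := by rw [card_singleton]
      omega

end C047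

end TriangleCap

end PercRepro
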